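import Mathlib
import HarnessLib
import Summits.HubbardSuperconductivity.HubbardSuperconductivity.Theorems.KLProgrammeKLRegimeSplitGlue
import Summits.HubbardSuperconductivity.HubbardSuperconductivity.Theorems.KLProgrammeKLRegimeSplitGenericV4
import Summits.HubbardSuperconductivity.HubbardSuperconductivity.Theorems.KLProgrammeKLRegimeSplitBundleV7
import Summits.HubbardSuperconductivity.HubbardSuperconductivity.Theorems.KLProgrammeKLRegimeVolumeLimitDefs

/-!
# Route `KLProgramme` — the K3-NAMED glue of the FIVE v4 children of crux K3 `KLRegimeTwoPointLimit`
# (stmt-HubbardSuperconductivity-19937; DOWNSTREAM of the route file; cell gate-hubbard-kl, seat p1 = C1 lead, g6)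

`KLRegimeInductionP4 (Pr) (VL)`: for EVERY predicate bundle `Pr : Preds` and EVERY volume-limit text `VL : VolLimitSlot`, the five generic
children of `KLProgrammeKLRegimeSplitGenericV4` on the covariance window — `EngineP4 Pr` (regime threshold `c ≤ c₃`, Δ17),
`BetaSplitP Pr`, `CountertermP2 Pr`, `VolumeLimitP2 Pr VL` (`c ≤ c₅`), `TwoPointAssemblyP3 Pr VL` at `klWindowC` — imply crux K3
`Theses.KLProgramme.KLRegimeTwoPointLimit` BY NAME (`k3_twoPointLimit_of_childrenP4` + the route's S0 theorem `MuOfDopingWindow_holds`).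
A bundle's closer is then ONE line: `KLRegimeInductionV7P4` below (bundle `klPredsV7`, volume-limit text `FinalTwoLegVolLimit`); the
gen-3 bundle's `KLRegimeInductionV8P4 := KLRegimeInductionP4 klPredsV8 FinalTwoLegVolLimit` lives next to `klPredsV8`.
(The v3 five-tuple's closer is `KLRegimeInductionP3` of `…SplitGlueP3`, same statement.)  Nothing else is asserted.
-/

noncomputable section

namespace Summit.HubbardSuperconductivity.HubbardSuperconductivity.Theorems.KLRegimeSplit

set_option linter.dupNamespace false -- summit = problem name (single-conjunct summit), D-0017

/-- **The K3-named glue for the five v4 children, every bundle and every volume-limit text**: `EngineP4`, `BetaSplitP`, `CountertermP2`,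
`VolumeLimitP2`, `TwoPointAssemblyP3` on the covariance window imply crux K3 `KLRegimeTwoPointLimit` BY NAME (constant staging
`G → P → R → Q → (c₀, c₁, c₃, c₅) → c := min (min c₀ c₁) (min c₃ c₅) → U₀`, strong induction to `n_β`, child 2's frame, the engine's
last step `n_β + 1`, child 5's volume limits, child 4; then S0 `MuOfDopingWindow_holds`). -/
theorem KLRegimeInductionP4 (Pr : Preds) (VL : VolLimitSlot) (h₃ : EngineP4 Pr klWindowC) (h₁ : BetaSplitP Pr klWindowC)
    (h₂ : CountertermP2 Pr klWindowC) (h₅ : VolumeLimitP2 Pr VL klWindowC) (h₄ : TwoPointAssemblyP3 Pr VL klWindowC) :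
    Summit.HubbardSuperconductivity.HubbardSuperconductivity.Theses.KLProgramme.KLRegimeTwoPointLimit :=
  k3_twoPointLimit_of_childrenP4 h₃ h₁ h₂ h₅ h₄
    Summit.HubbardSuperconductivity.HubbardSuperconductivity.Theses.KLProgramme.MuOfDopingWindow_holds

/-- **The K3-named v4 glue at the bundle `klPredsV7`**: `EngineP4 klPredsV7 klWindowC`, `BetaSplitP klPredsV7 klWindowC`,
`CountertermP2 klPredsV7 klWindowC`, `VolumeLimitP2 klPredsV7 FinalTwoLegVolLimit klWindowC`,
`TwoPointAssemblyP3 klPredsV7 FinalTwoLegVolLimit klWindowC` imply crux K3 `KLRegimeTwoPointLimit` BY NAME. -/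
theorem KLRegimeInductionV7P4 :
    EngineP4 klPredsV7 klWindowC → BetaSplitP klPredsV7 klWindowC → CountertermP2 klPredsV7 klWindowC →
      VolumeLimitP2 klPredsV7 FinalTwoLegVolLimit klWindowC → TwoPointAssemblyP3 klPredsV7 FinalTwoLegVolLimit klWindowC →
        Summit.HubbardSuperconductivity.HubbardSuperconductivity.Theses.KLProgramme.KLRegimeTwoPointLimit :=
  KLRegimeInductionP4 klPredsV7 FinalTwoLegVolLimit

end Summit.HubbardSuperconductivity.HubbardSuperconductivity.Theorems.KLRegimeSplit

end
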